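import Literature.AnabelianGeometry.EtaleTheta.Discharge.Sec1ZNUniquenessOfKummer
import Literature.AnabelianGeometry.EtaleTheta.SettingModelChiZNAllSplittings
import Literature.AnabelianGeometry.EtaleTheta.SettingModelTateZNAllSplittings
import Literature.AnabelianGeometry.EtaleTheta.SettingModelKrullZNAllSplittings
import HarnessLib

/-!
# [EtTh] §1 p. 14: the central-kernel clause `hcen` («`Π^tp_{Y_N}` centralises `(Δ^tp_{Y_N})^Θ` modulo
# `N·(Δ^tp_Y)^Θ`») HOLDS at the three models, and the model files B are instances of the ROOT theorem

Mochizuki, *The étale theta function …*, Publ. RIMS **45** (2009) [EtTh], §1 p. 14: «`1 → Δ_Θ ⊗ ℤ/Nℤ (≅ ℤ/Nℤ(1)) →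
(Π^tp_{Y_N})^Θ/N·(Δ^tp_Y)^Θ → G_{K_N} → 1`» [cite: MochizukiEtTh2009, §1 p.14].  abc-iut cell, layer L2, seat abc-iut-w5-d062
(gen 5); NON-VACUITY companion of this seat's root theorem `ThetaSetting.gtpZNFromSplitting_of_exists_of_stronglyComplete`
(`Discharge/Sec1ZNUniquenessOfKummer`, p470538).  PROOF-ONLY (no definition, no new named fact).

* `SettingModel.conj_mul_inv_mul_inv_eq_inl` — plain semidirect-product algebra in `Γ ⋊_φ G`: for `y` with trivial
  `G`-component, `g y g⁻¹ y⁻¹ = inl(γ · φ_σ(δ) · γ⁻¹ · δ⁻¹)` (`g = (γ, σ)`, `y = (δ, 1)`);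
* `Heis.mul_comm_of_x_eq_zero` — elements of `Heis(ℤ/N)` on `{x = 0}` commute;
* **`hcen_modelχ` / `hcen_modelχq` / `hcen_modelκ'`** — the binder `hcen` of the root theorem HOLDS at the χ-model, at the
  stage-2 («Tate shear») model (every `i`, even `j`) and at the cusped Krull model: the level shadow of `γ φ_σ(δ) γ⁻¹ δ⁻¹` is
  `ĥ(γ) ĥ(δ) ĥ(γ)⁻¹ ĥ(δ)⁻¹ = 1` because `σ ∈ G_{K_N}` acts level-trivially on degree zero and shadows of degree-zero
  elements lie on `{x = 0}`, which is abelian — so `θ(g y g⁻¹ y⁻¹) ∈ N·(Δ^tp_Y)^Θ` by the level-coordinate description of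
  `N·(Δ^tp_Y)^Θ` (abc-iut-L2-d1 / abc-iut-L2-t1: `toTheta…_inl_mem_thetaPowersY_iff`);
* (consistency, checked in staging and not re-landed — the statements coincide with the model files B p458978 / p463822 /
  p467332: `(ThetaSetting.modelχ p).gtpZNFromSplitting_of_exists_of_stronglyComplete hsc (hcen_modelχ p N)
  (exists_thetaSplitting_gtpZN_iff_modelχ p N)` and its χq / κ′ twins elaborate, i.e. the model files ARE instances of the root
  theorem);
SEMI-SYNTHETIC MODELS, consistency evidence only; nothing of [EtTh] asserted; no side taken on [IUTchIII] Cor. 3.12; typed ≠ proved.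
-/

noncomputable section

namespace Literature.AnabelianGeometry.EtaleTheta.SettingModel

open Literature.AnabelianGeometry.SemiGraphs _root_.Function

/-! ### Plain algebra: the commutator with a vertical element, and `{x = 0} ⊆ Heis` is abelian -/

/-- In `Γ ⋊_φ G`: for `y` with trivial `G`-component, `g y g⁻¹ y⁻¹` has trivial `G`-component and `Γ`-component
`g.left · φ_{g.right}(y.left) · g.left⁻¹ · y.left⁻¹`. [folklore] -/
private theorem conj_mul_inv_mul_inv_eq_inl {G : Type*} [Group G] {φ : G →* MulAut Gfp} (g y : Gfp ⋊[φ] G)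
    (hy : y.right = 1) :
    g * y * g⁻¹ * y⁻¹ = SemidirectProduct.inl (g.left * φ g.right y.left * g.left⁻¹ * y.left⁻¹) := by
  have hg : SemidirectProduct.inl g.left * SemidirectProduct.inr g.right = g :=
    SemidirectProduct.inl_left_mul_inr_right g
  have hy' : (SemidirectProduct.inl y.left : Gfp ⋊[φ] G) = y := by
    conv_rhs => rw [← SemidirectProduct.inl_left_mul_inr_right y, hy, map_one, mul_one]
  rw [map_mul, map_mul, map_mul, map_inv, map_inv, SemidirectProduct.inl_aut, map_inv]
  conv_lhs => rw [← hg, ← hy']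
  group

/-- Two elements of the Heisenberg group with vanishing `x`-coordinate commute. [folklore] -/
private theorem heis_mul_comm_of_x_eq_zero {R : Type*} [CommRing R] {a b : Heis R} (ha : a.x = 0) (hb : b.x = 0) :
    a * b = b * a := by
  ext <;> simp [ha, hb, add_comm]

/-- The level shadow of `γ · δ' · γ⁻¹ · δ⁻¹` is trivial when `ĥ(δ') = ĥ(δ)` and `γ`, `δ` have degree zero.
[cite: MochizukiEtTh2009, §1 p.14] -/
private theorem levelHom_conj_comm_eq_one (N : ℕ+) {γ δ δ' : Gfp} (hγ : γ ∈ gfpSnd.ker) (hδ : δ ∈ gfpSnd.ker)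
    (h : levelHom N δ' = levelHom N δ) : levelHom N (γ * δ' * γ⁻¹ * δ⁻¹) = 1 := by
  rw [map_mul, map_mul, map_mul, map_inv, map_inv, h,
    heis_mul_comm_of_x_eq_zero (levelHom_x_eq_zero hγ) (levelHom_x_eq_zero hδ)]
  group

variable (p : ℕ) [Fact p.Prime] (N : ℕ+)

/-! ### `hcen` at the χ-model -/

/-- **`hcen` HOLDS at the χ-model**: `Π^tp_{Y_N}` centralises `(Δ^tp_{Y_N})^Θ` modulo `N·(Δ^tp_Y)^Θ` (`G_{K_N}` acts
level-trivially, degree-zero shadows commute). [cite: MochizukiEtTh2009, §1 p.14] -/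
theorem hcen_modelχ : ∀ g ∈ (ThetaSetting.modelχ p).GtpYN N, ∀ y ∈ (ThetaSetting.modelχ p).DtpYN N,
    (ThetaSetting.modelχ p).toTheta g * (ThetaSetting.modelχ p).toTheta y * ((ThetaSetting.modelχ p).toTheta g)⁻¹ *
      ((ThetaSetting.modelχ p).toTheta y)⁻¹ ∈ (ThetaSetting.modelχ p).thetaPowersY N := by
  intro g hg y hy
  obtain ⟨hyY, hyΔ⟩ := Subgroup.mem_inf.mp hy
  have hy1 : y.right = 1 := hyΔ
  have hγ := (left_mem_dY_of_mem_YNχ p N hg).2.1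
  have hσ := (left_mem_dY_of_mem_YNχ p N hg).2.2
  have hδ := (left_mem_dY_of_mem_YNχ p N hyY).2.1
  rw [← map_mul, ← map_inv, ← map_mul, ← map_inv, ← map_mul, conj_mul_inv_mul_inv_eq_inl g y hy1]
  have hmem : g.left * actχ p g.right y.left * g.left⁻¹ * y.left⁻¹ ∈ gfpSnd.ker := by
    refine mul_mem (mul_mem (mul_mem hγ ?_) (inv_mem hγ)) (inv_mem hδ)
    rw [MonoidHom.mem_ker, (chiTwistData p).hdeg]; exact hδ
  exact (toTheta_inl_mem_thetaPowersY_iff p N hmem).mpr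
    (levelHom_conj_comm_eq_one N hγ hδ (levelHom_actχ_of_mem_GKN p N hσ y.left))

/-! ### `hcen` at the stage-2 («Tate shear») model -/

section Tate

variable (i j : ℤ) (hj : Even j)

/-- **`hcen` HOLDS at the stage-2 model** (every inner exponent `i`, even shear `j`): the Tate shear is invisible on degree
zero, where `G_{K_N}` acts as `diagTwist(χ_N σ) = id`. [cite: MochizukiEtTh2009, §1 p.14] -/
theorem hcen_modelχq : ∀ g ∈ (ThetaSetting.modelχq p i j hj).GtpYN N, ∀ y ∈ (ThetaSetting.modelχq p i j hj).DtpYN N,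
    (ThetaSetting.modelχq p i j hj).toTheta g * (ThetaSetting.modelχq p i j hj).toTheta y *
      ((ThetaSetting.modelχq p i j hj).toTheta g)⁻¹ * ((ThetaSetting.modelχq p i j hj).toTheta y)⁻¹ ∈
      (ThetaSetting.modelχq p i j hj).thetaPowersY N := by
  intro g hg y hy
  obtain ⟨hyY, hyΔ⟩ := Subgroup.mem_inf.mp hy
  have hy1 : y.right = 1 := hyΔ
  have hγ := (left_mem_dY_of_mem_YNχq p i j N hg).2.1
  have hσ := (left_mem_dY_of_mem_YNχq p i j N hg).2.2
  have hδ := (left_mem_dY_of_mem_YNχq p i j N hyY).2.1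
  rw [← map_mul, ← map_inv, ← map_mul, ← map_inv, ← map_mul, conj_mul_inv_mul_inv_eq_inl g y hy1]
  have hmem : g.left * actχq p i j g.right y.left * g.left⁻¹ * y.left⁻¹ ∈ gfpSnd.ker := by
    refine mul_mem (mul_mem (mul_mem hγ ?_) (inv_mem hγ)) (inv_mem hδ)
    rw [MonoidHom.mem_ker, gfpSnd_actχq]; exact hδ
  exact (toThetaq_inl_mem_thetaPowersY_iff p i j hj N hmem).mpr
    (levelHom_conj_comm_eq_one N hγ hδ (levelHom_actχq_of_mem_GKN_of_mem_ker p i j N hσ hδ))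

end Tate

/-! ### `hcen` at the cusped Krull model `modelκ′` -/

/-- **`hcen` HOLDS at `modelκ′`** (trivial Galois action on `Γ`: `actκ_apply_eq`). [cite: MochizukiEtTh2009, §1 p.14] -/
theorem hcen_modelκ' : ∀ g ∈ (ThetaSetting.modelκ' p).GtpYN N, ∀ y ∈ (ThetaSetting.modelκ' p).DtpYN N,
    (ThetaSetting.modelκ' p).toTheta g * (ThetaSetting.modelκ' p).toTheta y * ((ThetaSetting.modelκ' p).toTheta g)⁻¹ *
      ((ThetaSetting.modelκ' p).toTheta y)⁻¹ ∈ (ThetaSetting.modelκ' p).thetaPowersY N := by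
  intro g hg y hy
  obtain ⟨hyY, hyΔ⟩ := Subgroup.mem_inf.mp hy
  have hy1 : y.right = 1 := hyΔ
  have hγ := (left_mem_dY_of_mem_YNκ' p N hg).2.1
  have hδ := (left_mem_dY_of_mem_YNκ' p N hyY).2.1
  rw [← map_mul, ← map_inv, ← map_mul, ← map_inv, ← map_mul, conj_mul_inv_mul_inv_eq_inl g y hy1,
    actκ_apply_eq]
  have hmem : g.left * y.left * g.left⁻¹ * y.left⁻¹ ∈ gfpSnd.ker :=
    mul_mem (mul_mem (mul_mem hγ hδ) (inv_mem hγ)) (inv_mem hδ)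
  exact (toThetaκ'_inl_mem_thetaPowersY_iff p N hmem).mpr (levelHom_conj_comm_eq_one N hγ hδ rfl)

/-- **NV of the root theorem's binder `hcen` in the census shape**: SOME theta setting of [EtTh] origin that is a Tate origin
(the stage-2 model at `(i, j) = (0, 2)`) satisfies `hcen` and the ∃-form at every level. [cite: MochizukiEtTh2009, §1 p.14] -/
theorem exists_isTateOrigin_hcen_and_exists_splitting :
    ∃ D : ThetaSetting p, D.IsEtThOrigin ∧ D.IsTateOrigin ∧
      (∀ N : ℕ+, ∀ g ∈ D.GtpYN N, ∀ y ∈ D.DtpYN N,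
        D.toTheta g * D.toTheta y * (D.toTheta g)⁻¹ * (D.toTheta y)⁻¹ ∈ D.thetaPowersY N) ∧
      ∀ N : ℕ+, ∃ s₀ : ↥(D.GKN N) → D.GtpTheta, D.IsThetaSplittingAt N s₀ ∧
        ∀ g : D.PiTemp, g ∈ D.GtpZN N ↔ g ∈ D.GtpYN N ∧ ∃ h : D.aug g ∈ D.GJN N,
          D.toTheta g * (s₀ ⟨D.aug g, D.GJN_le_GKN N h⟩)⁻¹ ∈ D.thetaPowersY N :=
  ⟨ThetaSetting.modelχq p 0 2 even_two, ThetaSetting.modelχq_isEtThOrigin p 0 2 even_two, modelχq_isTateOrigin p 0,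
    fun N => hcen_modelχq p N 0 2 even_two, fun N => exists_thetaSplitting_gtpZN_iff_modelχq p 0 2 even_two N⟩

end Literature.AnabelianGeometry.EtaleTheta.SettingModel

end
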